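import Literature.IUT.HodgeArakelov.ThetaEnvDataRecordBridge
import Literature.IUT.HodgeArakelov.CohomologyLimitKummer
import Literature.IUT.HodgeArakelov.MonoThetaProjectiveThetaEnvRecord
import Literature.IUT.HodgeArakelov.TemperedThetaMonoidsSubdagProofs
import Literature.IUT.HodgeArakelov.TemperedThetaMonoidsProofs3
import HarnessLib

/-!
# [IUTchII] Prop 3.1 (i)(ii) AT THE MODEL: the produced record over the GENUINE `Π^tp_{X̲̲}` data — J1/J2/J4 instantiated

Proof-only companion (abc-iut cell, sub-DAG `plan/L6/SUBDAG-IUTchII-Prop-31-33-34.md`, W6-S6; row (γ) "J2/J4 AT THE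
MODEL once the J1 bridge exists"; seat abc-iut-w4-d019) of `ThetaEnvDataRecordBridge.lean` (p417552, the producer →
record data bridge `ThetaEnvData.toRecord`). S. Mochizuki, *Inter-universal Teichmüller theory II*, kurims manuscript
(Dec. 2020), §3 Prop. 3.1 (i) p. 87 l. 47–53 ("this collection of subsets is equipped with a natural conjugation action
by `Π_X(M^Θ_*)`"), (ii) p. 88 ("`Ψ_cns(M^Θ_*) := M_TM(M^Θ_*) ⊆ lim_J H¹(…)` … equipped with a natural conjugation action")
[cite: Mochizuki2012, Prop 3.1 (i) p.87]. Claim key `Mochizuki2012` (D-0012, DISPUTED): every theorem below is a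
construction/deduction over the cell's OWN objects (continuous group cohomology and its direct limit, classical
Kummer theory); nothing of the series is asserted; no side is taken on [IUTchIII] Cor. 3.12. NO definition of a
`Prop`; the one `def` (`EtaleLevels.thetaEnvRecord`) is an INSTANCE of the landed bridge.

WHAT IS PROVED / USED.
(A) J2 for the produced record with the hypotheses `hcompat`/`hθ`/`hinf` DISCHARGED at the genuine data and `hι` kept
BY NAME is abc-iut-w4-d030's `MonoThetaProjectiveThetaEnvRecord.lean` (`EtaleLevels.thetaEnvPermuted_record`, over
`EtaleThetaDataOfSettingConjStable.lean`) — consumed BY NAME; record level here: `ThetaEnvData.toRecord_units_stable`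
(`Ψ_cns` stable ⇒ `M^×_TM` stable).
(B) MODEL level (abc-iut-L6-t1's `cohomologySystemOfContH1 φ A H`, `H ⊴ Π`, abc-iut-w4-d043's `h1LimConjEquiv`,
`CohomologyLimitConj`): the family of inversion actions `g ↦ conj(g ι₀ g⁻¹)` indexed by `Π` is carried to itself by
conjugation (`h1LimConjEquiv_conjugate`: "conjugates of inversion automorphisms are inversion automorphisms",
Prop. 2.2 (i)) — the hypothesis `hι` of `thetaEnvPermuted_toRecord`.
(C) THE GENUINE RECORD: for abc-iut-w4-d030's `θ_env`-data `EtaleLevels.thetaEnvData` of the NATURAL projective system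
of model mono-theta environments of `X̲̲_K` (`MonoThetaProjectiveThetaEnv`; identity coefficient transport), the
Prop. 3.1 input record `EtaleLevels.thetaEnvRecord κ ι₀ := (thetaEnvData …).toRecord act κ iota` with
`act :=` abc-iut-w4-d007's `h1LimConjMulAut` (the conjugation action of `Π^tp_{X̲̲}` on `lim_J H¹(Π^tp_{Ÿ̲̲} ∩ J, l·Δ_Θ)`,
`CohomologyLimitKummer`), `iota g := h1LimConjEquiv (g ι₀ g⁻¹)` (the actions of the `Π^tp_{X̲̲}`-conjugates of ONE
inversion representative `ι₀ ∈ Π^tp_{X̲̲}` — [IUTchII] Rmk. 1.4.1 (ii): `ι` is induced by an element normalising `Π_Ÿ`)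
and any Kummer map `κ`. THEN: **J2 holds** — `thetaEnvPermuted_thetaEnvRecord : (thetaEnvRecord …).ThetaEnvPermuted`
(abc-iut-w5-d169's typed junction, p414772) — PROVED outright ((A) with its residual `hι` discharged by (B)); and with `κ :=` abc-iut-w4-d007's
`h1LimKummerOn c hA hfi O` (the Kummer map of a `Π`-stable submonoid `O` — `𝒪_k̄^▷` — of a discrete rootable
`Π`-module, through the cyclotomic-rigidity coefficient datum `c`): **`Ψ_cns` is conjugation-stable**
(`constantMonoid_stable_thetaEnvRecord`, the field `Prop31Statements.constants_stable`), `M^×_TM` is conjugation-stable,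
and **`Prop31Statements.conj_permutes` holds for BOTH families** (`conj_permutes_thetaEnvRecord`, via d169's
`conj_permutes_both_of_thetaEnvPermuted`, p416097). Finally **`prop31ii_thetaEnvRecordKummer`**
— [IUTchII] Prop. 3.1 (ii) BOTH printed clauses at the genuine record (Ψ_cns stable; `O ⥲ Ψ_cns` = κ on elements,
equivariant, unique; `M^×_TM = κ(O^×)`) from abc-iut-w4-d007's generic `TemperedThetaMonoidsProofs3` theorems under the
ONE input `hinj` (injectivity of the Kummer map into the limit; for `A = k̄ˣ` a THEOREM of abc-iut-w4-d007's
`CohomologyLimitKummerGalois`, `h1LimKummer_injective_of_aug`). The splitting clause (J3) is not touched here.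

**v2 (append-only; READING CORRECTION + the print-faithful family).** [IUTchII] Rmk. 1.4.1 (ii) p. 28: "the unique
order two automorphism `ι_X̲` of `X̲̲_k` over `k` … corresponds at the level of tempered fundamental groups … to the
unique order two `Δ^tp_{X̲̲_k}`-OUTER automorphism of `Π^tp_{X̲̲_k}` over `G_k`", and `ι_Ÿ` is "uniquely determined up to
`l·ℤ`-conjugacy and composition with an element `∈ Gal(Ÿ̲̲_k/Y̲̲_k)`". So print's inversions are NOT inner on
`Π^tp_{X̲̲}`: v1's `thetaEnvRecord κ ι₀` (conjugates of the INNER action of an element `ι₀ ∈ Π^tp_{X̲̲}`) realises the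
J2 mechanism only for the subfamily of translates by `Π^tp_{X̲̲}/Π^tp_{Ÿ̲̲} ≅ (l·ℤ) × μ_2` (honestly: a DEGENERATE choice
of "inversion" — the v1 docstrings' attribution to Rmk. 1.4.1 (ii) is withdrawn here). The faithful shape is the companion file
`ThetaEnvDataRecordModelOuter.lean`: `thetaEnvRecordOuter κ e₀` for ANY additive automorphism `e₀` of `lim_J H¹(Π^tp_{Ÿ̲̲} ∩ J, l·Δ_Θ)` — the action of ONE
pointed inversion `ι_Ÿ`, e.g. abc-iut-L6-t1/w4-d010/w5-d072's transport `h1LimAutEquiv` of the automorphism PAIR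
`(ι_Ÿ, ι^Θ)` — with the family `g ↦ conj_g ∘ e₀ ∘ conj_g⁻¹` of its `Π^tp_{X̲̲}`-conjugates ("up to `l·ℤ`-conjugacy and
`Gal(Ÿ̲̲/Y̲̲)`"); the conjugate-inversion law `hι` then holds by PURE GROUP THEORY for every `e₀`
(`h1LimConjEquiv_conjugate_outer`, THIS file, v2), so J2 at the genuine data holds for the print-faithful family with NO
hypothesis on `e₀` (companion file), where the `Ψ_cns`/`M^×_TM`/`conj_permutes`/Prop. 3.1 (ii) statements are
re-derived for it (the constant-monoid clauses do not depend on the inversion family).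
-/

noncomputable section

namespace Literature.IUT.HodgeArakelov

open Literature.AnabelianGeometry.EtaleTheta CohomologySystemOfContH1

universe u

/-! ### (A′) Record level: `M^×_TM` inherits conjugation-stability from `Ψ_cns` -/

namespace ThetaEnvData

variable {S : ThetaSetting.{u}} {F : ModelFamily S} {Sys : MonoThetaProjSystem F} (T : ThetaEnvData Sys)
  (act : Sys.PiX →* MulAut (Multiplicative T.cohEnv.lim)) {M : Type u} [CommMonoid M]
  (κ : M →* Multiplicative T.cohEnv.lim) {Iota : Type u} (iota : Iota → (T.D.coh.lim ≃+ T.D.coh.lim))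

/-- For the produced record, conjugation-stability of `Ψ_cns` implies conjugation-stability of its unit group
`M^×_TM` (automorphisms preserve inverses). [claim: Mochizuki2012, status: disputed] (IUTchII §3 Prop 3.1 (ii), kurims p.88) -/
theorem toRecord_units_stable
    (hC : ∀ (g : Sys.PiX) (x : (T.toRecord act κ iota).H),
      x ∈ (T.toRecord act κ iota).constantMonoid → (T.toRecord act κ iota).conj g x ∈ (T.toRecord act κ iota).constantMonoid)
    (g : Sys.PiX) (x : (T.toRecord act κ iota).H) (hx : x ∈ (T.toRecord act κ iota).units) :
    (T.toRecord act κ iota).conj g x ∈ (T.toRecord act κ iota).units := by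
  rw [mem_toRecord_units_iff] at hx ⊢
  exact ⟨hC g x hx.1, by rw [← map_inv]; exact hC g x⁻¹ hx.2⟩

end ThetaEnvData

/-! ### (B) Model level: conjugate inversions in `cohomologySystemOfContH1 φ A H` -/

namespace CohomologySystemOfContH1

section Model

variable {P : TopGroup.{u}} {G' : Type u} [Group G'] [TopologicalSpace G'] [IsTopologicalGroup G']
  (φ : P →* G') (A : Subgroup G') [A.Normal] [IsMulCommutative A] (H : Subgroup P) [H.Normal]

/-- The family of INNER actions `i ↦ conj(i ι₀ i⁻¹)` of the `Π`-conjugates of an element `ι₀ ∈ Π` is carried to itself by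
conjugation: `conj((g i) ι₀ (g i)⁻¹) ∘ conj(g) = conj(g) ∘ conj(i ι₀ i⁻¹)` — the hypothesis `hι` of
`thetaEnvPermuted_toRecord` for the v1 (inner, translate) family; the print-faithful OUTER version is
`h1LimConjEquiv_conjugate_outer`. [claim: Mochizuki2012, status: disputed] (IUTchII §2 Prop 2.2 (i), kurims p.66) -/
theorem h1LimConjEquiv_conjugate (ι₀ g i : P) (x : h1Lim φ A H ⊥) :
    h1LimConjEquiv φ A H ((g * i) * ι₀ * (g * i)⁻¹) (h1LimConjEquiv φ A H g x) =
      h1LimConjEquiv φ A H g (h1LimConjEquiv φ A H (i * ι₀ * i⁻¹) x) := by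
  simp only [h1LimConjEquiv_apply, ← h1LimConj_mul_apply]
  congr 1
  group

/-- **"Conjugates of inversion automorphisms are inversion automorphisms"** ([IUTchII] Prop. 2.2 (i); Rmk. 1.4.1 (ii): `ι_Ÿ`
is an OUTER automorphism, determined up to `l·ℤ`-conjugacy and `Gal(Ÿ̲̲/Y̲̲)`) in the cohomology limit, PRINT-FAITHFUL
form: for ANY additive automorphism `e₀` of the limit (the action of one inversion), the family of its `Π`-conjugates
`i ↦ conj_i ∘ e₀ ∘ conj_i⁻¹` satisfies `(conj_{g i} ∘ e₀ ∘ conj_{g i}⁻¹) ∘ conj_g = conj_g ∘ (conj_i ∘ e₀ ∘ conj_i⁻¹)` — pure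
group theory, NO hypothesis on `e₀`. [claim: Mochizuki2012, status: disputed] (IUTchII §2 Prop 2.2 (i), kurims p.66) -/
theorem h1LimConjEquiv_conjugate_outer (e₀ : h1Lim φ A H ⊥ ≃+ h1Lim φ A H ⊥) (g i : P) (x : h1Lim φ A H ⊥) :
    (((h1LimConjEquiv φ A H (g * i)).symm.trans e₀).trans (h1LimConjEquiv φ A H (g * i)))
        (h1LimConjEquiv φ A H g x) =
      h1LimConjEquiv φ A H g
        ((((h1LimConjEquiv φ A H i).symm.trans e₀).trans (h1LimConjEquiv φ A H i)) x) := by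
  simp only [AddEquiv.trans_apply, h1LimConjEquiv_apply]
  change h1LimConj φ A H (g * i) (e₀ (h1LimConj φ A H (g * i)⁻¹ (h1LimConj φ A H g x))) =
    h1LimConj φ A H g (h1LimConj φ A H i (e₀ (h1LimConj φ A H i⁻¹ x)))
  rw [← h1LimConj_mul_apply φ A H (g * i)⁻¹ g, ← h1LimConj_mul_apply φ A H g i]
  congr 3
  group

end Model

end CohomologySystemOfContH1

/-! ### (C) The genuine record over the natural projective system of `X̲̲_K` -/

namespace EtaleLevels

open EtaleThetaDataOfSetting

variable {p : ℕ} [Fact p.Prime] {D : Literature.AnabelianGeometry.EtaleTheta.ThetaSetting p}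
  {E : D.EtaleThetaData} {l : ℕ} (C : E.DoubleUnderline l) (hC : D.Compat) (hS : D.Sec2Hyps)
  (hl : l.Prime) (hp2 : p ≠ 2) (hpl : p ≠ l) (hζ : ∃ ζ : D.K, IsPrimitiveRoot ζ (4 * l))
  (mods : ∀ M : ℕ+, D.CyclotomeMod l M)
  (f : contCocycles D.toTheta D.DeltaTheta C.GtpYdduu) (hf : f ∈ C.rootCocycles hC)
  (hmods : ∀ (M M' : ℕ+) (h : (M : ℕ) ∣ (M' : ℕ)) (x : D.lDeltaTheta l),
    MuN.red p M M' h ((mods M').red x) = (mods M).red x)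
  (h15 : Literature.AnabelianGeometry.EtaleTheta.ThetaSetting.Prop15iii E hC) (L : C.CuspLabels)
  (hZ : ∀ M : ℕ+, Nonempty (ModelCyclotomes.lDeltaQuot (C.rigidData (mods M) hC hS h15 L) ≃*
    Literature.IUT.HodgeTheaters.ZHat))
  (hcharY : EtaleThetaDataOfSetting.PiYddCharacteristic C)
  (hlim : Function.Bijective (rigidLimHom C hC hS hl hp2 hpl hζ mods f hf hmods h15 L hZ))
  [(EtaleThetaDataOfSetting.PiYdd C).Normal]

/-- **The [IUTchII] Prop. 3.1 input record of the NATURAL system `𝕄_*` of `X̲̲_K`** (J1 at the model): abc-iut-w4-d030's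
`θ_env`-data `thetaEnvData` (Prop. 1.5 (iii) for the natural system; ambient module
`lim_J H¹(Π^tp_{Ÿ̲̲} ∩ J, l·Δ_Θ)` = abc-iut-L6-t1's `cohomologySystemOfContH1`, identity coefficient transport) pushed
through the bridge `ThetaEnvData.toRecord` with: the conjugation ACTION of `Π^tp_{X̲̲}` on the limit (abc-iut-w4-d007's
`h1LimConjMulAut`), a Kummer map `κ` of the constant monoid (a datum; e.g. `h1LimKummerOn`), and — v1 SHAPE, see the
module docstring's v2 note — the family of conjugates `g ι₀ g⁻¹` of the INNER action of one element `ι₀ ∈ Π^tp_{X̲̲}`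
(abc-iut-w4-d043's `h1LimConjEquiv`); this covers the translates by `Π^tp_{X̲̲}/Π^tp_{Ÿ̲̲} ≅ (l·ℤ) × μ_2` only, NOT print's
outer inversion `ι_Ÿ` (Rmk. 1.4.1 (ii)) — for that use `thetaEnvRecordOuter`. [claim: Mochizuki2012, status: disputed] (IUTchII §3 Prop 3.1 (i), kurims p.87) -/
def thetaEnvRecord {M : Type} [CommMonoid M]
    (κ : M →* Multiplicative (h1Lim (phi C) (D.lDeltaTheta l) (PiYdd C) ⊥)) (ι₀ : Pi C) :
    TemperedThetaMonoids.ThetaEnvData.{0, 0}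
      (modelSystem C hC hS hl hp2 hpl hζ mods f hf hmods h15 L hZ).PiX :=
  (thetaEnvData C hC hS hl hp2 hpl hζ mods f hf hmods h15 L hZ hcharY hlim).toRecord
    (h1LimConjMulAut (phi C) (D.lDeltaTheta l) (PiYdd C)) κ
    (fun g : Pi C => h1LimConjEquiv (phi C) (D.lDeltaTheta l) (PiYdd C) (g * ι₀ * g⁻¹))

include hcharY in
/-- **J2 AT THE MODEL** ([IUTchII] Prop. 3.1 (i) p. 87 l. 47–53 "this collection of subsets is equipped with a natural
conjugation action by `Π_X(M^Θ_*)`"): for the genuine record, the conjugation action of `Π^tp_{X̲̲}` PERMUTES the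
families `{θ^ι_env}_ι`, `{∞θ^ι_env}_ι` — abc-iut-w5-d169's typed junction `ThetaEnvPermuted` HOLDS, by the bridge's
composition of abc-iut-w4-d030's `thetaEnvPermuted_record` (its residual `hι`) with the conjugate-inversion law (B)
— so for THIS inversion family J2 holds with NO residual hypothesis. [claim: Mochizuki2012, status: disputed] (IUTchII §3 Prop 3.1 (i), kurims p.87) -/
theorem thetaEnvPermuted_thetaEnvRecord {M : Type} [CommMonoid M]
    (κ : M →* Multiplicative (h1Lim (phi C) (D.lDeltaTheta l) (PiYdd C) ⊥)) (ι₀ : Pi C) :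
    (thetaEnvRecord C hC hS hl hp2 hpl hζ mods f hf hmods h15 L hZ hcharY hlim κ ι₀).ThetaEnvPermuted := by
  refine thetaEnvPermuted_record C hC hS hl hp2 hpl hζ mods f hf hmods h15 L hZ hcharY hlim κ _ fun g i => ?_
  exact ⟨g * i, fun x => h1LimConjEquiv_conjugate (phi C) (D.lDeltaTheta l) (PiYdd C) ι₀ g i x⟩

/-! #### With abc-iut-w4-d007's Kummer map of a `Π`-stable constant monoid `O` ("`Ψ_cns := M_TM`") -/

section Kummer

variable {A : Type} [CommGroup A] [MulDistribMulAction (Pi C) A] [TopologicalSpace A] [RootableBy A ℕ]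
  (c : CyclotomeCoefficients (phi C) (D.lDeltaTheta l) A)
  (hA : ∀ b : A, IsOpen (MulAction.stabilizer (Pi C) b : Set (Pi C)))
  (hfi : ∀ b : A, (MulAction.stabilizer (Pi C) b).FiniteIndex)
  (O : Submonoid A) (hO : ∀ (σ : Pi C) (b : A), b ∈ O → σ • b ∈ O) (ι₀ : Pi C)

/-- The genuine record with `κ :=` abc-iut-w4-d007's Kummer map `h1LimKummerOn c hA hfi O` of the `Π^tp_{X̲̲}`-stable
constant monoid `O ≤ A` (the MLF model: `O = 𝒪_k̄^▷ ≤ k̄ˣ = A`) through the cyclotomic-rigidity coefficient datum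
`c : Λ(A) → l·Δ_Θ` — "`Ψ_cns(M^Θ_*) := M_TM(M^Θ_*)`". (Abbreviation of an instance of `thetaEnvRecord`.)
[claim: Mochizuki2012, status: disputed] (IUTchII §3 Prop 3.1 (ii), kurims p.88) -/
abbrev thetaEnvRecordKummer :
    TemperedThetaMonoids.ThetaEnvData.{0, 0} (modelSystem C hC hS hl hp2 hpl hζ mods f hf hmods h15 L hZ).PiX :=
  thetaEnvRecord C hC hS hl hp2 hpl hζ mods f hf hmods h15 L hZ hcharY hlim
    (h1LimKummerOn (phi C) (D.lDeltaTheta l) (PiYdd C) c hA hfi O) ι₀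

include hcharY hO in
/-- **`Ψ_cns` is conjugation-stable at the model** (the field `Prop31Statements.constants_stable`, [IUTchII] Prop. 3.1
(ii) p. 88 "equipped with a natural conjugation action by `Π_X(M^Θ_*)`"): with `κ := h1LimKummerOn c hA hfi O`, the
Kummer map of the `Π^tp_{X̲̲}`-stable constant monoid `O` into the genuine limit (abc-iut-w4-d007), the constant monoid
`Ψ_cns = κ(O)` of the genuine record is carried into itself by every `g ∈ Π^tp_{X̲̲}` (equivariance
`h1LimKummerOn_smul`). [claim: Mochizuki2012, status: disputed] (IUTchII §3 Prop 3.1 (ii), kurims p.88) -/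
theorem constantMonoid_stable_thetaEnvRecord :
      (thetaEnvRecordKummer C hC hS hl hp2 hpl hζ mods f hf hmods h15 L hZ hcharY hlim c hA hfi O ι₀).IsConjStable
      (thetaEnvRecordKummer C hC hS hl hp2 hpl hζ mods f hf hmods h15 L hZ hcharY hlim c hA hfi O ι₀).constantMonoid := by
  intro g' x hx
  -- `Π_X(𝕄_*)` is `Π^tp_{X̲̲}` on the nose
  let g : Pi C := g'
  change x ∈ MonoidHom.mrange _ at hx
  obtain ⟨m, rfl⟩ := hx
  change h1LimConjMulAut (phi C) (D.lDeltaTheta l) (PiYdd C) g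
      (h1LimKummerOn (phi C) (D.lDeltaTheta l) (PiYdd C) c hA hfi O m) ∈ MonoidHom.mrange _
  exact ⟨⟨g • (m : A), hO g m m.2⟩,
    h1LimKummerOn_smul (phi C) (D.lDeltaTheta l) (PiYdd C) c hA hfi O g m ⟨g • (m : A), hO g m m.2⟩ rfl⟩

include hcharY hO in
/-- `M^×_TM` of the genuine record is conjugation-stable (units of the stable `Ψ_cns`).
[claim: Mochizuki2012, status: disputed] (IUTchII §3 Prop 3.1 (ii), kurims p.88) -/
theorem units_stable_thetaEnvRecord :
      ∀ (g : Pi C) (x : (thetaEnvRecordKummer C hC hS hl hp2 hpl hζ mods f hf hmods h15 L hZ hcharY hlim c hA hfi O ι₀).H),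
      x ∈ (thetaEnvRecordKummer C hC hS hl hp2 hpl hζ mods f hf hmods h15 L hZ hcharY hlim c hA hfi O ι₀).units →
      (thetaEnvRecordKummer C hC hS hl hp2 hpl hζ mods f hf hmods h15 L hZ hcharY hlim c hA hfi O ι₀).conj g x ∈
      (thetaEnvRecordKummer C hC hS hl hp2 hpl hζ mods f hf hmods h15 L hZ hcharY hlim c hA hfi O ι₀).units := by
  exact (thetaEnvData C hC hS hl hp2 hpl hζ mods f hf hmods h15 L hZ hcharY hlim).toRecord_units_stable _ _ _
    (constantMonoid_stable_thetaEnvRecord C hC hS hl hp2 hpl hζ mods f hf hmods h15 L hZ hcharY hlim c hA hfi O hO ι₀)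

include hcharY hO in
/-- **`Prop31Statements.conj_permutes` AT THE MODEL, for BOTH families** ([IUTchII] Prop. 3.1 (i) p. 87): every
`g ∈ Π^tp_{X̲̲}` carries `Ψ^ι_env` onto `Ψ^{ι'}_env` and `∞Ψ^ι_env` onto `∞Ψ^{ι'}_env` for `ι' = g ι g⁻¹` — by J2 at the model
and the stability of `M^×_TM`, through abc-iut-w5-d169's closer `conj_permutes_both_of_thetaEnvPermuted` (p416097).
[claim: Mochizuki2012, status: disputed] (IUTchII §3 Prop 3.1 (i), kurims p.87) -/
theorem conj_permutes_thetaEnvRecord :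
      ∀ (g : Pi C) (ι : Pi C), ∃ ι' : Pi C,
      ((thetaEnvRecordKummer C hC hS hl hp2 hpl hζ mods f hf hmods h15 L hZ hcharY hlim c hA hfi O ι₀).thetaMonoid ι).map
        ((thetaEnvRecordKummer C hC hS hl hp2 hpl hζ mods f hf hmods h15 L hZ hcharY hlim c hA hfi O ι₀).conj g).toMonoidHom =
        (thetaEnvRecordKummer C hC hS hl hp2 hpl hζ mods f hf hmods h15 L hZ hcharY hlim c hA hfi O ι₀).thetaMonoid ι' ∧
      ((thetaEnvRecordKummer C hC hS hl hp2 hpl hζ mods f hf hmods h15 L hZ hcharY hlim c hA hfi O ι₀).inftyThetaMonoid ι).map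
        ((thetaEnvRecordKummer C hC hS hl hp2 hpl hζ mods f hf hmods h15 L hZ hcharY hlim c hA hfi O ι₀).conj g).toMonoidHom =
        (thetaEnvRecordKummer C hC hS hl hp2 hpl hζ mods f hf hmods h15 L hZ hcharY hlim c hA hfi O ι₀).inftyThetaMonoid ι' := by
  intro g ι
  exact TemperedThetaMonoids.ThetaEnvData.conj_permutes_both_of_thetaEnvPermuted _
    (thetaEnvPermuted_thetaEnvRecord C hC hS hl hp2 hpl hζ mods f hf hmods h15 L hZ hcharY hlim _ ι₀)
    (units_stable_thetaEnvRecord C hC hS hl hp2 hpl hζ mods f hf hmods h15 L hZ hcharY hlim c hA hfi O hO ι₀) g ι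

include hcharY hO in
/-- **[IUTchII] Prop. 3.1 (ii) AT THE GENUINE RECORD — both printed clauses** (p. 88: "`Ψ_cns(M^Θ_*) := M_TM(M^Θ_*)` …
naturally isomorphic to `O^▷_{F̄_v}` … equipped with a natural conjugation action by `Π_X(M^Θ_*)`"), from
abc-iut-w4-d007's generic consumer theorems (`TemperedThetaMonoidsProofs3`) applied to `thetaEnvRecordKummer`, under
the ONE input "the Kummer map into the limit is injective" (`hinj`; discharged for `A = k̄ˣ` under any topological
group acting through a continuous homomorphism to `G_k` by abc-iut-w4-d007's `h1LimKummer_injective_of_aug`,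
`CohomologyLimitKummerGalois`): `Ψ_cns` is conjugation-stable; there is an isomorphism `O ⥲ Ψ_cns` which IS the
Kummer map on elements, INTERTWINES the action of `Π^tp_{X̲̲}` on `O` with the conjugation action, and is UNIQUE as
such; and `M^×_TM = κ(O^×)`. [claim: Mochizuki2012, status: disputed] (IUTchII §3 Prop 3.1 (ii), kurims p.88) -/
theorem prop31ii_thetaEnvRecordKummer
    (hinj : Function.Injective (h1LimKummer (phi C) (D.lDeltaTheta l) (PiYdd C) c hA hfi)) :
    (thetaEnvRecordKummer C hC hS hl hp2 hpl hζ mods f hf hmods h15 L hZ hcharY hlim c hA hfi O ι₀).IsConjStable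
        (thetaEnvRecordKummer C hC hS hl hp2 hpl hζ mods f hf hmods h15 L hZ hcharY hlim c hA hfi O ι₀).constantMonoid ∧
      (∃ e : O ≃*
          (thetaEnvRecordKummer C hC hS hl hp2 hpl hζ mods f hf hmods h15 L hZ hcharY hlim c hA hfi O ι₀).constantMonoid,
        (∀ x : O, ((e x : (thetaEnvRecordKummer C hC hS hl hp2 hpl hζ mods f hf hmods h15 L hZ hcharY hlim
              c hA hfi O ι₀).constantMonoid) : (thetaEnvRecordKummer C hC hS hl hp2 hpl hζ mods f hf hmods h15 L hZ hcharY hlim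
              c hA hfi O ι₀).H) =
            h1LimKummerOn (phi C) (D.lDeltaTheta l) (PiYdd C) c hA hfi O x) ∧
        (∀ (g : Pi C) (x : O),
          ((e ⟨g • (x : A), hO g x x.2⟩ : (thetaEnvRecordKummer C hC hS hl hp2 hpl hζ mods f hf hmods h15 L hZ hcharY
              hlim c hA hfi O ι₀).constantMonoid) : (thetaEnvRecordKummer C hC hS hl hp2 hpl hζ mods f hf hmods h15 L hZ hcharY hlim
              c hA hfi O ι₀).H) =
            h1LimConjMulAut (phi C) (D.lDeltaTheta l) (PiYdd C) g
              ((e x : (thetaEnvRecordKummer C hC hS hl hp2 hpl hζ mods f hf hmods h15 L hZ hcharY hlim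
                c hA hfi O ι₀).constantMonoid) : (thetaEnvRecordKummer C hC hS hl hp2 hpl hζ mods f hf hmods h15 L hZ hcharY hlim
              c hA hfi O ι₀).H)) ∧
        (∀ e' : O ≃*
            (thetaEnvRecordKummer C hC hS hl hp2 hpl hζ mods f hf hmods h15 L hZ hcharY hlim c hA hfi O ι₀).constantMonoid,
          (∀ x : O, ((e' x : (thetaEnvRecordKummer C hC hS hl hp2 hpl hζ mods f hf hmods h15 L hZ hcharY hlim
                c hA hfi O ι₀).constantMonoid) : (thetaEnvRecordKummer C hC hS hl hp2 hpl hζ mods f hf hmods h15 L hZ hcharY hlim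
              c hA hfi O ι₀).H) =
              h1LimKummerOn (phi C) (D.lDeltaTheta l) (PiYdd C) c hA hfi O x) → e' = e)) ∧
      (∀ x : O, h1LimKummerOn (phi C) (D.lDeltaTheta l) (PiYdd C) c hA hfi O x ∈
          (thetaEnvRecordKummer C hC hS hl hp2 hpl hζ mods f hf hmods h15 L hZ hcharY hlim c hA hfi O ι₀).units ↔
        IsUnit x) := by
  have hinjO := h1LimKummerOn_injective (phi C) (D.lDeltaTheta l) (PiYdd C) c hA hfi O hinj
  refine ⟨constantMonoid_stable_thetaEnvRecord C hC hS hl hp2 hpl hζ mods f hf hmods h15 L hZ hcharY hlim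
      c hA hfi O hO ι₀, ?_, fun x => ?_⟩
  · obtain ⟨e, he⟩ := TemperedThetaMonoids.exists_constantMonoid_mulEquiv
      (thetaEnvRecordKummer C hC hS hl hp2 hpl hζ mods f hf hmods h15 L hZ hcharY hlim c hA hfi O ι₀)
      (h1LimKummerOn (phi C) (D.lDeltaTheta l) (PiYdd C) c hA hfi O) hinjO rfl
    refine ⟨e, he, fun g x => ?_, fun e' he' => ?_⟩
    · rw [he, he]
      exact h1LimKummerOn_smul (phi C) (D.lDeltaTheta l) (PiYdd C) c hA hfi O g x ⟨g • (x : A), hO g x x.2⟩ rfl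
    · exact TemperedThetaMonoids.constantMonoid_mulEquiv_unique
        (thetaEnvRecordKummer C hC hS hl hp2 hpl hζ mods f hf hmods h15 L hZ hcharY hlim c hA hfi O ι₀)
        (h1LimKummerOn (phi C) (D.lDeltaTheta l) (PiYdd C) c hA hfi O) e' e he' he
  · exact TemperedThetaMonoids.kummer_mem_units_iff
      (thetaEnvRecordKummer C hC hS hl hp2 hpl hζ mods f hf hmods h15 L hZ hcharY hlim c hA hfi O ι₀)
      (h1LimKummerOn (phi C) (D.lDeltaTheta l) (PiYdd C) c hA hfi O) hinjO rfl x

end Kummer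

end EtaleLevels

end Literature.IUT.HodgeArakelov

end
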